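import Summits.NavierStokesRegularity.FluidComputer.PalasekTowerRegisterGlobalMargin
import Summits.NavierStokesRegularity.FluidComputer.PalasekTowerRegisterGlobalHalves

/-!
# REGISTER v2.3′: the rescaled-copy alphabet of line `fc-oneshot` — vocabulary by name

Cell `ns-blowup`, seat `ns-blowup-fc-prover-3` (g0; D-0074 GROUP C/E «bridge support», re-point of
director-ns 2026-08-26T03:36:55Z); companion of `PalasekTowerRegisterGlobal.lean` (p411629: the items
of record `EpisodeBaseG` / `EpisodeInductionG` of the route `PalasekTowerBreakdown`, items
stmt-NavierStokesRegularity-19179 / -19178), `PalasekTowerRegisterGlobalHeredity.lean` (p415576: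
`HeredityAtOne` = item -19249, `HeredityFrom 2` = item -19250) and `PalasekTowerRegisterGlobalMargin.lean`
(p420640: the design class as a margin conjunct, `Margins.withDesign`, `HeredityAtGM`). LABEL: E–C typing
(KERNEL vocabulary: one relation, two readout predicates, the line's open `Prop`s BY NAME, bookkeeping).
WHAT THIS IS NOT: not Navier–Stokes evidence — no stage, letter, tower or instance is constructed or
claimed; the `@[conjecture]` definitions are OPEN statements of the crux line and are never asserted.

## Why

The ACTIVE LINE on the crux `EpisodeInduction` (item -19178) is `fc-oneshot` v2.2 (planner seat
`ns-blowup-fc-route` g0, skeleton 7a76d86a2251fc20, registered 2026-08-26T03:32:54Z): stubs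
`stub_heredityAtOne : …Theses.PalasekTowerBreakdown.HeredityAtOne` (the child item -19249 by name),
`stub_capture : Capture`, `stub_renormalise : Renormalise`, composition
`EpisodeInduction_of : FirstGate → Capture → Renormalise → …EpisodeInduction`. Its vocabulary — the
relation `RescaledCopy` («on the window of radius `4/N_k` anchored at a level-`k` floor point of `v`,
`v` is, up to a rigid motion and a translation, `w` rescaled by amplitude `Y_k/Y_j` and length `N_j/N_k`,
with sup-error `δ·Y_k`»), the gate predicate `Runs` and the readout predicate `Letter` — lived only in the
line's workfile. This module puts it IN THE TREE, VERBATIM (so the line's stubs can be re-pointed at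
these names by `Iff.rfl`, as v2.2 did for `HeredityAtOne`), together with:

* §1 `RescaledCopy` and its cheap API: monotone in the tolerance, the anchor is a level-`k` floor point
  (`.floor`), the tolerance is nonnegative, the copy CENTRE is a `(c₁ - δ)`-floor point of the PARENT
  letter (`.parent_floor`: the relation is never met by copying a calm patch of the parent either), and
  an exact anchored zoom is a `0`-copy (`.of_zoom`: the relation is the intended one and is satisfiable
  as a relation between fields);
* §2 `Runs` / `Letter`, with `Letter.of_stage` (every readout of a registered stage IS a letter),
  `Runs.of_extends`, and `Stage.exists_extends_iff_runs_letter` — «`s` extends to a registered stage at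
  level `k+1`» ⇔ «some continuation RUNS and carries the next LETTER» (the tree's
  `Stage.nonempty_extends_of_continuation`, p415576, as an equivalence);
* §3 the line's open statements BY NAME — `Capture` (alphabet closure, ∀ `k ≥ 2`), `Renormalise` (the
  robust one-shot gate, ∀ `k ≥ 2`) — and three bookkeeping names used by the companion analysis
  `PalasekTowerRescaledCopyHeredity.lean`: the copy relation as a DESIGN conjunct `CopyDesign : Margins`
  (so that `Renormalise` is heredity IN the design `Margins.withDesign CopyDesign (Margins.routeG _)`,
  card fc-oneshot v3.3 CROSS-REFERENCE), its one-level truncation `CaptureAt k`, and the first gate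
  WITH copy output `FirstGateCopy` (= designed heredity at level `1`).

References: T. Tao, J. Amer. Math. Soc. 29 (2016) 601–674, §1.3 (fluid-computer programme: robust
gates, self-similar alphabet) [cite: Tao2016AveragedNS, §1.3]; S. Palasek, arXiv:2605.13827 §3.3–§4
[cite: Palasek2026ElementaryModel, §4].
-/

noncomputable section

namespace Summit.NavierStokesRegularity.FluidComputer.PalasekTowerClayBridge

open Set MeasureTheory Filter Topology Function Real
open scoped ENNReal ContDiff NNReal
open Literature.Analysis.FluidPDE

/-! ## §1 The rescaled-copy relation -/

/-- **Rescaled copy** (the alphabet relation of the fluid computer, typed on the register; line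
`fc-oneshot` v2.2 verbatim): on the window `closedBall x₁ (4/N_k)` ANCHORED at a level-`k` floor point
`x₁` of `v` (`‖v x₁‖ ≥ c₁ Y_k` — so the copy is of the active letter, not of a calm patch of the ball),
the level-`k` field `v` is, up to the rigid motion `Q` and the translation `x₀ ↦ x₁` (both centres in
the tower's ball), the level-`j` field `w` rescaled by amplitude `Y_k/Y_j` and length `N_j/N_k`, with
sup-error `δ·Y_k`. [cite: Tao2016AveragedNS, §1.3] -/
def RescaledCopy (S : Schedule TowerRates.wide) (j k : ℕ)
    (w v : EuclideanSpace ℝ (Fin 3) → EuclideanSpace ℝ (Fin 3)) (δ : ℝ) : Prop :=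
  ∃ (Q : EuclideanSpace ℝ (Fin 3) ≃ₗᵢ[ℝ] EuclideanSpace ℝ (Fin 3)) (x₀ x₁ : EuclideanSpace ℝ (Fin 3)),
    ‖x₀‖ ≤ S.radius ∧ ‖x₁‖ ≤ S.radius ∧ S.c₁ * TowerRates.wide.Y k ≤ ‖v x₁‖ ∧
    ∀ y ∈ Metric.closedBall x₁ (4 / TowerRates.wide.N k),
      ‖v y - (TowerRates.wide.Y k / TowerRates.wide.Y j) •
          Q (w (x₀ + (TowerRates.wide.N k / TowerRates.wide.N j) • Q.symm (y - x₁)))‖ ≤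
        δ * TowerRates.wide.Y k

namespace RescaledCopy

variable {S : Schedule TowerRates.wide} {j k : ℕ}
  {w v : EuclideanSpace ℝ (Fin 3) → EuclideanSpace ℝ (Fin 3)} {δ δ' : ℝ}

/-- The copy relation is monotone in the tolerance. [folklore] -/
theorem mono (h : RescaledCopy S j k w v δ) (hδ : δ ≤ δ') : RescaledCopy S j k w v δ' := by
  obtain ⟨Q, x₀, x₁, h₀, h₁, hfl, hw⟩ := h
  refine ⟨Q, x₀, x₁, h₀, h₁, hfl, fun y hy => (hw y hy).trans ?_⟩
  have hY : 0 < TowerRates.wide.Y k := Real.rpow_pos_of_pos (TowerRates.wide.N_pos _) _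
  exact mul_le_mul_of_nonneg_right hδ hY.le

/-- The anchor of a rescaled copy is a level-`k` floor point of the CHILD field in the ball (so the
relation is never met on a calm patch). [folklore] -/
theorem floor (h : RescaledCopy S j k w v δ) :
    ∃ x, ‖x‖ ≤ S.radius ∧ S.c₁ * TowerRates.wide.Y k ≤ ‖v x‖ := by
  obtain ⟨-, -, x₁, -, h₁, hfl, -⟩ := h
  exact ⟨x₁, h₁, hfl⟩

/-- The tolerance of a rescaled copy is nonnegative (read the window clause at the anchor). [folklore] -/
theorem nonneg (h : RescaledCopy S j k w v δ) : 0 ≤ δ := by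
  obtain ⟨Q, x₀, x₁, -, -, -, hw⟩ := h
  have hY : 0 < TowerRates.wide.Y k := Real.rpow_pos_of_pos (TowerRates.wide.N_pos _) _
  have hN : 0 < TowerRates.wide.N k := TowerRates.wide.N_pos _
  have h1 := hw x₁ (Metric.mem_closedBall_self (by positivity))
  have h2 := (norm_nonneg _).trans h1
  nlinarith

/-- **The copy centre is a floor-type point of the PARENT letter**: at the anchor the window clause
reads `‖v x₁ - (Y_k/Y_j) • Q (w x₀)‖ ≤ δ Y_k` with `‖v x₁‖ ≥ c₁ Y_k`, so `‖w x₀‖ ≥ (c₁ - δ) Y_j` — for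
`δ = 2/3`, `c₁ = 1` the parent letter has speed `≥ Y_j / 3` at `x₀` (the relation copies an active part
of the parent, never a calm patch). [folklore] -/
theorem parent_floor (h : RescaledCopy S j k w v δ) :
    ∃ x, ‖x‖ ≤ S.radius ∧ (S.c₁ - δ) * TowerRates.wide.Y j ≤ ‖w x‖ := by
  obtain ⟨Q, x₀, x₁, h₀, -, hfl, hw⟩ := h
  refine ⟨x₀, h₀, ?_⟩
  have hYk : 0 < TowerRates.wide.Y k := Real.rpow_pos_of_pos (TowerRates.wide.N_pos _) _
  have hYj : 0 < TowerRates.wide.Y j := Real.rpow_pos_of_pos (TowerRates.wide.N_pos _) _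
  have hN : 0 < TowerRates.wide.N k := TowerRates.wide.N_pos _
  have h1 := hw x₁ (Metric.mem_closedBall_self (by positivity))
  simp only [sub_self, map_zero, smul_zero, add_zero] at h1
  set c : ℝ := TowerRates.wide.Y k / TowerRates.wide.Y j with hc_def
  have hc : 0 < c := div_pos hYk hYj
  have hnorm : ‖c • Q (w x₀)‖ = c * ‖w x₀‖ := by
    rw [norm_smul, LinearIsometryEquiv.norm_map, Real.norm_of_nonneg hc.le]
  have h2 : ‖v x₁‖ - ‖c • Q (w x₀)‖ ≤ δ * TowerRates.wide.Y k :=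
    (norm_sub_norm_le _ _).trans h1
  rw [hnorm] at h2
  have hck : c * TowerRates.wide.Y j = TowerRates.wide.Y k := div_mul_cancel₀ _ hYj.ne'
  have h3 : c * ((S.c₁ - δ) * TowerRates.wide.Y j) ≤ c * ‖w x₀‖ := by
    calc c * ((S.c₁ - δ) * TowerRates.wide.Y j) = (S.c₁ - δ) * (c * TowerRates.wide.Y j) := by ring
      _ = (S.c₁ - δ) * TowerRates.wide.Y k := by rw [hck]
      _ ≤ c * ‖w x₀‖ := by linarith
  exact le_of_mul_le_mul_left h3 hc

/-- **An exact anchored zoom is a `0`-copy** (the relation is the intended one, and is satisfiable as a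
relation between fields): rescaling a parent field `w` about a point `x₀` of the ball where it has the
parent floor speed `c₁ Y_j`, by a rigid motion `Q`, amplitude `Y_k/Y_j` and length `N_j/N_k`, and
re-centring at any `x₁` of the ball, gives a field that is a rescaled copy of `w` with tolerance `0`.
[folklore] -/
theorem of_zoom (Q : EuclideanSpace ℝ (Fin 3) ≃ₗᵢ[ℝ] EuclideanSpace ℝ (Fin 3))
    {x₀ x₁ : EuclideanSpace ℝ (Fin 3)} (h₀ : ‖x₀‖ ≤ S.radius) (h₁ : ‖x₁‖ ≤ S.radius)
    (hfl : S.c₁ * TowerRates.wide.Y j ≤ ‖w x₀‖) :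
    RescaledCopy S j k w
      (fun y => (TowerRates.wide.Y k / TowerRates.wide.Y j) •
        Q (w (x₀ + (TowerRates.wide.N k / TowerRates.wide.N j) • Q.symm (y - x₁)))) 0 := by
  have hYk : 0 < TowerRates.wide.Y k := Real.rpow_pos_of_pos (TowerRates.wide.N_pos _) _
  have hYj : 0 < TowerRates.wide.Y j := Real.rpow_pos_of_pos (TowerRates.wide.N_pos _) _
  refine ⟨Q, x₀, x₁, h₀, h₁, ?_, fun y _ => by simp⟩
  simp only [sub_self, map_zero, smul_zero, add_zero, norm_smul, LinearIsometryEquiv.norm_map]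
  rw [Real.norm_of_nonneg (div_pos hYk hYj).le]
  have hck : TowerRates.wide.Y k / TowerRates.wide.Y j * TowerRates.wide.Y j = TowerRates.wide.Y k :=
    div_mul_cancel₀ _ hYj.ne'
  calc S.c₁ * TowerRates.wide.Y k
      = TowerRates.wide.Y k / TowerRates.wide.Y j * (S.c₁ * TowerRates.wide.Y j) := by
        rw [mul_left_comm, hck]
    _ ≤ TowerRates.wide.Y k / TowerRates.wide.Y j * ‖w x₀‖ :=
        mul_le_mul_of_nonneg_left hfl (div_pos hYk hYj).le

end RescaledCopy

/-! ## §2 The gate predicate and the readout predicate -/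

/-- **The gate runs** (line `fc-oneshot` v2.2 verbatim): `(u, p)` is a classical finite-energy
continuation of the registered stage `s` to `τ (k+1)` (same force — zero after `τ 1` on a quiet
schedule), agreeing with it on `[0, τ k]`, inside the level-`(k+1)` ceiling `c₂ Y_{k+1}`.
[cite: Palasek2026ElementaryModel, §4] -/
def Runs (S : Schedule TowerRates.wide) (k : ℕ)
    (s : Stage 1 TowerRates.wide S (Margins.routeG TowerRates.wide) k)
    (u : ℝ → EuclideanSpace ℝ (Fin 3) → EuclideanSpace ℝ (Fin 3)) (p : ℝ → EuclideanSpace ℝ (Fin 3) → ℝ) :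
    Prop :=
  IsClassicalNSSolutionOn (Icc 0 (S.τ (k + 1))) 1 S.f u p ∧
    (∀ t ∈ Icc 0 (S.τ k), u t = s.u t ∧ p t = s.p t) ∧
    (∃ C : ℝ≥0∞, C < ⊤ ∧ ∀ t ∈ Icc 0 (S.τ (k + 1)), ∫⁻ x, ‖u t x‖ₑ ^ 2 ≤ C) ∧
    (∀ t ∈ Icc 0 (S.τ (k + 1)), ∀ x, ‖u t x‖ ≤ S.c₂ * TowerRates.wide.Y (k + 1))

/-- **Letter of level `m`** (line `fc-oneshot` v2.2 verbatim): the register's three readout clauses for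
a field `v` — velocity floor `c₁ Y_m`, strain floor `c₁ A_m`, and a core loop of level `m` (in a ball
of radius `1/N_m` centred in the tower's ball, speed `≤ 8π/N_m`, circulation `≥ c₁ N_m^{β-2}`).
[cite: Palasek2026ElementaryModel, §3.1] -/
def Letter (S : Schedule TowerRates.wide) (m : ℕ)
    (v : EuclideanSpace ℝ (Fin 3) → EuclideanSpace ℝ (Fin 3)) : Prop :=
  (∃ x, ‖x‖ ≤ S.radius ∧ S.c₁ * TowerRates.wide.Y m ≤ ‖v x‖) ∧
    (∃ x, ‖x‖ ≤ S.radius ∧ S.c₁ * TowerRates.wide.A m ≤ ‖fderiv ℝ v x‖) ∧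
    (∃ (x : EuclideanSpace ℝ (Fin 3)) (γ : ℝ → EuclideanSpace ℝ (Fin 3)),
      ‖x‖ ≤ S.radius ∧ ContDiff ℝ 1 γ ∧ γ 0 = γ 1 ∧
      (∀ σ ∈ Icc (0 : ℝ) 1, γ σ ∈ Metric.closedBall x (1 / TowerRates.wide.N m)) ∧
      (∀ σ ∈ Icc (0 : ℝ) 1, ‖deriv γ σ‖ ≤ 8 * π / TowerRates.wide.N m) ∧
      S.c₁ * TowerRates.wide.N m ^ (TowerRates.wide.β - 2) ≤ circulation v γ)

/-- **Every readout of a registered stage is a letter**: at each grown level `j ≤ k` a `routeG` stage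
carries at `τ j` the velocity floor (`Stage.floor`), the strain floor (`Stage.routeG_strain`) and the
core loop (`Stage.routeG_coreLedger`) of level `j` — the alphabet of the line IS the registered class.
[folklore] -/
theorem Letter.of_stage {S : Schedule TowerRates.wide} {k : ℕ}
    (s : Stage 1 TowerRates.wide S (Margins.routeG TowerRates.wide) k) {j : ℕ} (hj : j ≤ k) :
    Letter S j (s.u (S.τ j)) :=
  ⟨s.floor j hj, s.routeG_strain j hj, s.routeG_coreLedger j hj⟩

/-- The extension stage's own velocity and pressure RUN (classical continuation, agreement, finite
energy, and the top ceiling of the new level). [folklore] -/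
theorem Runs.of_extends {S : Schedule TowerRates.wide} {k : ℕ}
    (s : Stage 1 TowerRates.wide S (Margins.routeG TowerRates.wide) k)
    (s' : Stage 1 TowerRates.wide S (Margins.routeG TowerRates.wide) (k + 1)) (h : s.Extends s') :
    Runs S k s s'.u s'.p :=
  ⟨s'.classical, h, s'.energy, fun t ht x => s'.ceiling (k + 1) le_rfl t ht x⟩

/-- **Heredity unbundled through the gate**: a registered stage at level `k` extends to one at level
`k + 1` iff some continuation RUNS and carries the level-`(k+1)` LETTER at `τ (k+1)` (⇐ is the tree's
`Stage.nonempty_extends_of_continuation`: earlier clauses by agreement, the new quiet clause by window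
equality, the global anchor inherited; rigidity is read off the stage's own margin). [folklore] -/
theorem Stage.exists_extends_iff_runs_letter {S : Schedule TowerRates.wide} {k : ℕ}
    (s : Stage 1 TowerRates.wide S (Margins.routeG TowerRates.wide) k) :
    (∃ s' : Stage 1 TowerRates.wide S (Margins.routeG TowerRates.wide) (k + 1), s.Extends s') ↔
      ∃ (u : ℝ → EuclideanSpace ℝ (Fin 3) → EuclideanSpace ℝ (Fin 3))
        (p : ℝ → EuclideanSpace ℝ (Fin 3) → ℝ), Runs S k s u p ∧ Letter S (k + 1) (u (S.τ (k + 1))) := by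
  constructor
  · rintro ⟨s', hs'⟩
    exact ⟨s'.u, s'.p, Runs.of_extends s s' hs', Letter.of_stage s' le_rfl⟩
  · rintro ⟨u, p, ⟨hcl, hagree, henergy, hceil⟩, ⟨hfloor, hstrain, hcore⟩⟩
    exact s.nonempty_extends_of_continuation s.routeG_rigid hcl hagree henergy hceil hfloor hstrain
      hcore

/-! ## §3 The line's open statements by name; the copy design -/

/-- **CAPTURE — alphabet closure** (line `fc-oneshot` v2.2 stub `stub_capture`, verbatim; OPEN, never
asserted): in every globally anchored registered stage at level `k ≥ 2` of a pinned (`Λ = 8`,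
`θ = 6/5`), rigid, quiet schedule on the wide-base rates, the level-`k` letter is a `2/3`-rescaled copy
(anchored at a floor point) of the level-`(k-1)` letter of the same stage — «registered towers are
discretely self-similar». The line's declared MOST KILLABLE bet (MODEL falsifier: COPY-FIT-1).
[cite: Tao2016AveragedNS, §1.3] -/
@[conjecture] def Capture : Prop :=
  ∀ S : Schedule TowerRates.wide, S.Pins 8 (6 / 5) → S.Rigid → S.Quiet → ∀ k : ℕ, 2 ≤ k →
    ∀ s : Stage 1 TowerRates.wide S (Margins.routeG TowerRates.wide) k,
      RescaledCopy S (k - 1) k (s.u (S.τ (k - 1))) (s.u (S.τ k)) (2 / 3)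

/-- **Capture AT level `k`** (OPEN for every `k ≥ 2`; never asserted): the one-level truncation of
`Capture` — every registered stage at level `k` is a `2/3`-copy between its letters of levels `k - 1`
and `k`. `Capture ↔ ∀ k ≥ 2, CaptureAt k` (`capture_iff_forall_captureAt`). [cite: Tao2016AveragedNS, §1.3] -/
@[conjecture] def CaptureAt (k : ℕ) : Prop :=
  ∀ S : Schedule TowerRates.wide, S.Pins 8 (6 / 5) → S.Rigid → S.Quiet →
    ∀ s : Stage 1 TowerRates.wide S (Margins.routeG TowerRates.wide) k,
      RescaledCopy S (k - 1) k (s.u (S.τ (k - 1))) (s.u (S.τ k)) (2 / 3)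

/-- **RENORMALISE — the robust one-shot gate, uniformly in `k ≥ 2`** (line `fc-oneshot` v2.2 stub
`stub_renormalise`, verbatim; OPEN, never asserted; the line's LOAD-BEARING stub): a registered
level-`k` letter that is a `2/3`-copy of its predecessor runs, unforced over the rigid window, to a
continuation inside the next ceiling whose field at `τ (k+1)` is a level-`(k+1)` letter AND a
`2/3`-rescaled copy of the level-`k` letter. [cite: Tao2016AveragedNS, §1.3] -/
@[conjecture] def Renormalise : Prop :=
  ∀ S : Schedule TowerRates.wide, S.Pins 8 (6 / 5) → S.Rigid → S.Quiet → ∀ k : ℕ, 2 ≤ k →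
    ∀ s : Stage 1 TowerRates.wide S (Margins.routeG TowerRates.wide) k,
      RescaledCopy S (k - 1) k (s.u (S.τ (k - 1))) (s.u (S.τ k)) (2 / 3) →
      ∃ (u : ℝ → EuclideanSpace ℝ (Fin 3) → EuclideanSpace ℝ (Fin 3))
        (p : ℝ → EuclideanSpace ℝ (Fin 3) → ℝ),
        Runs S k s u p ∧ Letter S (k + 1) (u (S.τ (k + 1))) ∧
        RescaledCopy S k (k + 1) (s.u (S.τ k)) (u (S.τ (k + 1))) (2 / 3)

/-- **FIRST GATE WITH COPY OUTPUT** (OPEN; never asserted): every registered level-`1` stage extends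
to a registered level-`2` stage whose level-`2` letter is a `2/3`-copy of the level-`1` letter —
`HeredityAtOne` with the alphabet seeded at the first hand-over (= heredity at level `1` IN the copy
design, `firstGateCopy_iff_heredityAtGM_withDesign` in the companion module). [cite: Tao2016AveragedNS, §1.3] -/
@[conjecture] def FirstGateCopy : Prop :=
  ∀ S : Schedule TowerRates.wide, S.Pins 8 (6 / 5) → S.Rigid → S.Quiet →
    ∀ s : Stage 1 TowerRates.wide S (Margins.routeG TowerRates.wide) 1,
      ∃ s' : Stage 1 TowerRates.wide S (Margins.routeG TowerRates.wide) 2,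
        s.Extends s' ∧ RescaledCopy S 1 2 (s.u (S.τ 1)) (s'.u (S.τ 2)) (2 / 3)

/-- **The copy relation as a DESIGN conjunct** (a `Margins`-valued predicate, to be used as
`Margins.withDesign CopyDesign m`): from level `2` on, the velocity history's letter at `τ k` is a
`2/3`-rescaled copy of its letter at `τ (k-1)`; no clause below level `2`. [folklore] -/
def CopyDesign : Margins TowerRates.wide := fun S k u =>
  2 ≤ k → RescaledCopy S (k - 1) k (u (S.τ (k - 1))) (u (S.τ k)) (2 / 3)

/-- `Capture` is the conjunction of its one-level truncations. [folklore] -/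
theorem capture_iff_forall_captureAt : Capture ↔ ∀ k, 2 ≤ k → CaptureAt k :=
  ⟨fun h k hk S hP hR hQ s => h S hP hR hQ k hk s, fun h S hP hR hQ k hk s => h k hk S hP hR hQ s⟩

/-- `Capture` contains each truncation `CaptureAt k`, `k ≥ 2`. [folklore] -/
theorem Capture.captureAt (h : Capture) {k : ℕ} (hk : 2 ≤ k) : CaptureAt k :=
  capture_iff_forall_captureAt.1 h k hk

/-- **`Capture` says: every registered stage is IN the copy design** (at its own level; the design has
no clause below level `2`). [folklore] -/
theorem capture_iff_copyDesign :
    Capture ↔ ∀ S : Schedule TowerRates.wide, S.Pins 8 (6 / 5) → S.Rigid → S.Quiet → ∀ k : ℕ,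
      ∀ s : Stage 1 TowerRates.wide S (Margins.routeG TowerRates.wide) k, CopyDesign S k s.u :=
  ⟨fun h S hP hR hQ k s hk => h S hP hR hQ k hk s, fun h S hP hR hQ k hk s => h S hP hR hQ k s hk⟩

/-- A registered stage satisfying `Capture`'s conclusion is a stage IN the copy design (same flow).
[folklore] -/
def Stage.toCopyDesign {S : Schedule TowerRates.wide} {k : ℕ}
    (s : Stage 1 TowerRates.wide S (Margins.routeG TowerRates.wide) k) (h : CopyDesign S k s.u) :
    Stage 1 TowerRates.wide S (Margins.withDesign CopyDesign (Margins.routeG TowerRates.wide)) k :=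
  s.toWithDesign h

/-- … with the same velocity. [folklore] -/
@[simp] theorem Stage.toCopyDesign_u {S : Schedule TowerRates.wide} {k : ℕ}
    (s : Stage 1 TowerRates.wide S (Margins.routeG TowerRates.wide) k) (h : CopyDesign S k s.u) :
    (s.toCopyDesign h).u = s.u :=
  rfl

/-- Below level `2` the copy design is empty of content: every registered stage at level `0` or `1` is
in it. [folklore] -/
theorem copyDesign_of_lt_two {S : Schedule TowerRates.wide} {k : ℕ} (hk : k < 2)
    (u : ℝ → EuclideanSpace ℝ (Fin 3) → EuclideanSpace ℝ (Fin 3)) : CopyDesign S k u :=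
  fun h => absurd h (not_le.2 hk)

end Summit.NavierStokesRegularity.FluidComputer.PalasekTowerClayBridge

end
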